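import Summits.BirchSwinnertonDyer.BirchSwinnertonDyer.Theorems.PrintCf2RamifiedOffTYZSquareSilenceStabiliser
import Summits.BirchSwinnertonDyer.BirchSwinnertonDyer.Theorems.PrintCf2RamifiedOffTYZSquareSilenceTwoABC
import HarnessLib

/-!
# Crux `PrintCf2.RamifiedOffTYZOfFacts` (stmt-BirchSwinnertonDyer-20509), line `offtyz-v7`, LEAD cycle 14 (cruxlead-20509 g13):
# THE LOWER HALF OF C⁺ ON THE CELL `n = 2abc`, `a ≡ 3`, `b ≡ c ≡ 7 (mod 8)`, `(b/a) = (c/a) = −1` — type `(3,7,7)`, `s = 3`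

THEOREMS ONLY (no `def`, no named fact, no `sorry`), `--supports stmt-BirchSwinnertonDyer-20509` (C⁺ = item 23431; the second `k = 3` even residual type of
g12's census — 17 of the 95 even `k = 3` members `≤ 45000` with `s ≥ 2`; `s(2abc) = 3` for `a ≡ 3`, `b ≡ c ≡ 7 (mod 8)` iff `(b/a) = (c/a) = −1`, crux
workfile `Lines/offtyz_v7_RegimeFreeLaw.md`).  The DEEP-REGIME type: the top rows of `φ_b`, `φ_c` coincide (`#ker N_n = 4`, `χ_n ≡ 0`), so the PAIR
`φ_bφ_c` is an `L_n(i)`-trivial involution class outside `Gal(ℍ′_n/H_n)` (g12's `FrobeniusPairWitness`) — a top WITNESS; the blocks `ab, ac ≡ 5 (mod 8)`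
are composite and unwitnessed, but g8's recursion never reaches them (`R(n) = {b, c, 2a}`, `R(b) = R(c) = R(2a) = ∅` up to blocks `≢ 5`), which is
exactly what the refined stabiliser silence (`SquareSilenceStabiliser`, p743249) allows.
* §1 divisors of `2abc` for the residues `(3,7,7)`; a block `≡ 5` below a member of a recursion index forces the member `≡ 2 (mod 8)` — impossible.
* §2 the pair `φ_bφ_c` is trivial on `L_n(i)` (Euler symbols; the own radical `√−b` by sign tracking through `√−(2a)`, `√−(2ac)`, `√−n`).
* §3 the cell theorem, display shape and `OfFacts` shape `two_dvd_scriptL_three_seven_seven_of_facts`.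
BSD is not proved by any of this; no class is closed by this file.

References: [cite: TianYuanZhang2017, Thm. 3.5 (p0011 L94–L100), Lemma 3.18, §3.1 (p0011 L53–L73), Prop. 3.2 (2), Thm. 3.6 (2), proof of Lemma 3.21 (p0020 L27–L63)];
[cite: Cox2013, §1 (1.13)–(1.15), §5.C Lemma 5.19, (5.22), Thm. 5.23, Cor. 5.25, §9.A]; [cite: Stevenhagen1995RedeiMatrices, §2]; [cite: Darmon2004, Thm. 3.22].
-/

noncomputable section

open scoped Classical

open WeierstrassCurve WeierstrassCurve.Affine Finset Literature.NumberTheory.EllipticCurves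
  Literature.NumberTheory.EllipticCurves.TianYuanZhang2017
  Literature.NumberTheory.EllipticCurves.TianYuanZhang2017.W2
  Summit.BirchSwinnertonDyer.Rank1Residual.P2.GenusPeriodTransferLayer
  Summit.BirchSwinnertonDyer.Rank1Residual.P2.ThetaDescent
  Summit.BirchSwinnertonDyer.Rank1Residual.P2
  Summit.BirchSwinnertonDyer.PrintCf2.MoverAssembly
  Summit.BirchSwinnertonDyer.PrintCf2.SquareSilenceEven
  Summit.BirchSwinnertonDyer.PrintCf2.SquareSilenceWitnesses
  Summit.BirchSwinnertonDyer.PrintCf2.FrobeniusPairWitness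
  Summit.BirchSwinnertonDyer.PrintCf2.TwoRPQFive
  Summit.BirchSwinnertonDyer.PrintCf2.TwoABC
  Summit.BirchSwinnertonDyer.PrintCf2.SquareSilenceStabiliser

set_option autoImplicit false

namespace Summit.BirchSwinnertonDyer.PrintCf2.ThreeSevenSeven

variable {n : ℕ} (D : GenusPointData n)

/-! ## §1 Divisors of `2abc`, `a ≡ 3`, `b ≡ c ≡ 7 (mod 8)` -/

/-- **Residues of the divisors of `2abc`** (`a ≡ 3`, `b ≡ c ≡ 7 (mod 8)` primes): a divisor `≡ 5 (mod 8)` is `ab` or `ac`; a divisor `≡ 6 (mod 8)` is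
`2a, 2b, 2c` or `2abc`. [cite: TianYuanZhang2017, §3.1 (p0011 L67–L70)] -/
theorem divisors_two_abc_377 {a b c : ℕ} (ha : Nat.Prime a) (hb : Nat.Prime b) (hc : Nat.Prime c) (ha8 : a % 8 = 3) (hb8 : b % 8 = 7)
    (hc8 : c % 8 = 7) {d : ℕ} (hd : d ∣ 2 * a * b * c) :
    (d % 8 = 5 → d = a * b ∨ d = a * c) ∧ (d % 8 = 6 → d = 2 * a ∨ d = 2 * b ∨ d = 2 * c ∨ d = 2 * a * b * c) := by
  have hd' : d ∣ 2 * (a * b * c) := by rw [show 2 * (a * b * c) = 2 * a * b * c by ring]; exact hd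
  have hab : (a * b) % 8 = 5 := by rw [Nat.mul_mod, ha8, hb8]
  have hac : (a * c) % 8 = 5 := by rw [Nat.mul_mod, ha8, hc8]
  have hbc : (b * c) % 8 = 1 := by rw [Nat.mul_mod, hb8, hc8]
  have habc : (a * b * c) % 8 = 3 := by rw [Nat.mul_mod, hab, hc8]
  rcases SixPQ.dvd_or_two_mul_dvd_of_dvd_two_mul hd' with h | ⟨d', rfl, h⟩
  · rcases (dvd_mul_three_iff ha hb hc).mp h with rfl | rfl | rfl | rfl | rfl | rfl | rfl | rfl
    · omega
    · omega
    · omega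
    · omega
    · exact ⟨fun _ => Or.inl rfl, by omega⟩
    · exact ⟨fun _ => Or.inr rfl, by omega⟩
    · omega
    · omega
  · rcases (dvd_mul_three_iff ha hb hc).mp h with rfl | rfl | rfl | rfl | rfl | rfl | rfl | rfl
    · omega
    · exact ⟨by omega, fun _ => Or.inl rfl⟩
    · exact ⟨by omega, fun _ => Or.inr (Or.inl rfl)⟩
    · exact ⟨by omega, fun _ => Or.inr (Or.inr (Or.inl rfl))⟩
    · omega
    · omega
    · omega
    · exact ⟨by omega, fun _ => Or.inr (Or.inr (Or.inr (by ring)))⟩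

/-- **The recursion never reaches a block `≡ 5 (mod 8)`** on the `(3,7,7)` cell: if `d₂ ≡ 5 (mod 8)` lies in `recursionIndex d₁` for a divisor `d₁` of
`2abc`, then `d₁ ≡ 2 (mod 8)` (`d₂ ∈ {ab, ac}`, and the admissible cofactors `q ∣ 2c` resp. `2b` with `q ≡ 1, 2, 3 (mod 8)`, `q > 1` reduce to `q = 2`)
— so `d₁` is never itself a member of a recursion index (`≢ 5, 6, 7`). [cite: TianYuanZhang2017, §3.1 (p0011 L67–L73)] -/
theorem mod_eight_eq_two_of_five_mem_recursionIndex {a b c : ℕ} (ha : Nat.Prime a) (hb : Nat.Prime b) (hc : Nat.Prime c) (ha8 : a % 8 = 3)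
    (hb8 : b % 8 = 7) (hc8 : c % 8 = 7)
    {d₁ d₂ : ℕ} (hd₁ : d₁ ∣ 2 * a * b * c) (hd₂ : d₂ ∈ recursionIndex d₁) (h5 : d₂ % 8 = 5) : d₁ % 8 = 2 := by
  obtain ⟨hd₂d, -, h123, hgt⟩ := mem_recursionIndex_iff.mp hd₂
  have hd₂dvd : d₂ ∣ d₁ := Nat.dvd_of_mem_divisors hd₂d
  have hd₁0 : d₁ ≠ 0 := (Nat.mem_divisors.mp hd₂d).2
  obtain ⟨q, hq⟩ := hd₂dvd
  have hq0 : 0 < d₂ := by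
    rcases (divisors_two_abc_377 ha hb hc ha8 hb8 hc8 (((Dvd.intro q hq.symm)).trans hd₁)).1 h5 with rfl | rfl
    · exact Nat.mul_pos ha.pos hb.pos
    · exact Nat.mul_pos ha.pos hc.pos
  have hqd : d₁ / d₂ = q := by rw [hq, Nat.mul_div_cancel_left q hq0]
  rw [hqd] at h123 hgt
  -- `d₂ ∈ {ab, ac}` and `q` divides the cofactor `2c` resp. `2b`
  have key : ∀ {x y : ℕ}, x.Prime → y.Prime → y % 8 = 7 → d₂ = a * x → q ∣ 2 * y → d₁ % 8 = 2 := by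
    intro x y hx hy hy8 hd₂eq hqy
    have hq2y : q = 1 ∨ q = 2 ∨ q = y ∨ q = 2 * y := by
      rcases SixPQ.dvd_or_two_mul_dvd_of_dvd_two_mul hqy with h | ⟨q', rfl, h⟩
      · rcases (Nat.dvd_prime hy).mp h with rfl | rfl
        · exact Or.inl rfl
        · exact Or.inr (Or.inr (Or.inl rfl))
      · rcases (Nat.dvd_prime hy).mp h with rfl | rfl
        · exact Or.inr (Or.inl rfl)
        · exact Or.inr (Or.inr (Or.inr rfl))
    rcases hq2y with rfl | rfl | rfl | rfl
    · omega
    · rw [hq, Nat.mul_mod, h5]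
    · omega
    · omega
  rcases (divisors_two_abc_377 ha hb hc ha8 hb8 hc8 ((Dvd.intro q hq.symm).trans hd₁)).1 h5 with h | h
  · -- `d₂ = ab`, `q ∣ 2c`
    refine key hb hc hc8 h ?_
    have : a * b * q ∣ a * b * (2 * c) := by
      rw [show a * b * (2 * c) = 2 * a * b * c by ring, ← h, ← hq]; exact hd₁
    exact Nat.dvd_of_mul_dvd_mul_left (Nat.mul_pos ha.pos hb.pos) this
  · -- `d₂ = ac`, `q ∣ 2b`
    refine key hc hb hb8 h ?_
    have : a * c * q ∣ a * c * (2 * b) := by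
      rw [show a * c * (2 * b) = 2 * a * b * c by ring, ← h, ← hq]; exact hd₁
    exact Nat.dvd_of_mul_dvd_mul_left (Nat.mul_pos ha.pos hc.pos) this

/-! ## §2 The pair `φ_bφ_c` is trivial on `L_n(i)` -/

/-- **The Frobenius pair `φ_bφ_c` of `n = 2abc` (`a ≡ 3`, `b ≡ c ≡ 7 (mod 8)`, `(b/a) = (c/a) = −1`) is trivial on `L_n(i)`**: both factors negate `i` and
`√−2` and fix `√−a` (`(−a/b) = −(a/b) = (b/a)·(−1)·(−1)… = −1`? no: `(−a/b) = (−1/b)(a/b) = −(−(b/a)) = (b/a) = −1`, likewise for `c`), so the product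
fixes `i, √−2, √−a`; with `t = (c/b)`: `φ_c(√−b) = (−b/c)√−b = t·√−b` and, tracking signs through `√−(2a)`, `√−(2ac)`, `√−n`, `φ_b(√−b) = t·√−b`, so the
product fixes `√−b`; the own radical `√−c` comes from `√−n`. [cite: TianYuanZhang2017, §3.1 (p0011 L60–L66), Prop. 3.2 (2)] [cite: Cox2013, §1 (1.13)–(1.15), §5.C (5.22)] -/
theorem trivialOnL_pair_377 (hsq : Squarefree n) {a b c : ℕ} (ha : a.Prime) (hb : b.Prime) (hc : c.Prime) (hn : n = 2 * a * b * c)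
    (ha8 : a % 8 = 3) (hb8 : b % 8 = 7) (hc8 : c % 8 = 7) (hba : jacobiSym (b : ℤ) a = -1) (hca : jacobiSym (c : ℤ) a = -1)
    {φ₁ φ₂ : D.H ≃ₐ[ℚ] D.H}
    (h₁K : φ₁ (D.sqrtNeg n) = D.sqrtNeg n) (h₁i : φ₁ D.im = (jacobiSym (-1) b) • D.im)
    (h₁r : ∀ r : ℕ, r.Prime → r ∣ n → r ≠ b → φ₁ (D.sqrtNeg r) = (jacobiSym (-(r : ℤ)) b) • D.sqrtNeg r)
    (h₂K : φ₂ (D.sqrtNeg n) = D.sqrtNeg n) (h₂i : φ₂ D.im = (jacobiSym (-1) c) • D.im)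
    (h₂r : ∀ r : ℕ, r.Prime → r ∣ n → r ≠ c → φ₂ (D.sqrtNeg r) = (jacobiSym (-(r : ℤ)) c) • D.sqrtNeg r) :
    D.TrivialOnL n (φ₁ * φ₂) := by
  have hn0 : n ≠ 0 := hsq.ne_zero
  have hm : ∀ {d : ℕ}, d ∣ n → d ∈ n.divisors := fun hd => Nat.mem_divisors.mpr ⟨hd, hn0⟩
  have hb2 : b ≠ 2 := by omega
  have hc2 : c ≠ 2 := by omega
  have ha4 : a % 4 = 3 := by omega
  have hb4 : b % 4 = 3 := by omega
  have hc4 : c % 4 = 3 := by omega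
  have hab : a ≠ b := by omega
  have hac : a ≠ c := by omega
  have hbc : b ≠ c := by
    rintro rfl; exact hb.one_lt.ne' (Nat.isUnit_iff.mp (hsq b ⟨2 * a, by rw [hn]; ring⟩))
  have hbo : Odd b := hb.odd_of_ne_two hb2
  have hco : Odd c := hc.odd_of_ne_two hc2
  -- divisibility
  have d2 : 2 ∣ n := ⟨a * b * c, by rw [hn]; ring⟩
  have da : a ∣ n := ⟨2 * b * c, by rw [hn]; ring⟩
  have db : b ∣ n := ⟨2 * a * c, by rw [hn]; ring⟩
  have dc : c ∣ n := ⟨2 * a * b, by rw [hn]; ring⟩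
  have d2a : 2 * a ∣ n := ⟨b * c, by rw [hn]; ring⟩
  have d2ac : 2 * a * c ∣ n := ⟨b, by rw [hn]; ring⟩
  have hn' : 2 * a * c * b ∈ n.divisors := by rw [show 2 * a * c * b = n by rw [hn]; ring]; exact Nat.mem_divisors_self n hn0
  -- Jacobi values
  have vᵢb : jacobiSym (-1) b = -1 := by rw [jacobiSym.at_neg_one hbo, ZMod.χ₄_nat_three_mod_four hb4]
  have vᵢc : jacobiSym (-1) c = -1 := by rw [jacobiSym.at_neg_one hco, ZMod.χ₄_nat_three_mod_four hc4]
  have hχ : ∀ m : ℕ, Odd m → jacobiSym (-2) m = if m % 8 = 1 ∨ m % 8 = 3 then 1 else -1 := fun m hmo => by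
    rw [jacobiSym.at_neg_two hmo, ZMod.χ₈'_nat_eq_if_mod_eight, if_neg (by rw [Nat.odd_iff] at hmo; omega)]
  have v2b : jacobiSym (-2) b = -1 := by rw [hχ b hbo, if_neg (by omega)]
  have v2c : jacobiSym (-2) c = -1 := by rw [hχ c hco, if_neg (by omega)]
  have hab' : jacobiSym (a : ℤ) b = 1 := by
    rw [jacobiSym.quadratic_reciprocity_three_mod_four ha4 hb4, hba]; norm_num
  have hac' : jacobiSym (a : ℤ) c = 1 := by
    rw [jacobiSym.quadratic_reciprocity_three_mod_four ha4 hc4, hca]; norm_num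
  have vab : jacobiSym (-(a : ℤ)) b = -1 := by rw [neg_eq_neg_one_mul, jacobiSym.mul_left, vᵢb, hab']; norm_num
  have vac : jacobiSym (-(a : ℤ)) c = -1 := by rw [neg_eq_neg_one_mul, jacobiSym.mul_left, vᵢc, hac']; norm_num
  -- `t = (c/b)`, `(−c/b) = −t`, `(−b/c) = t`
  set t : ℤ := jacobiSym (c : ℤ) b with htdef
  have ht1 : t = 1 ∨ t = -1 :=
    jacobiSym.eq_one_or_neg_one (by rw [Int.gcd_natCast_natCast]; exact (Nat.coprime_primes hc hb).mpr hbc.symm)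
  have htt : t * t = 1 := by rcases ht1 with h | h <;> rw [h] <;> norm_num
  have vcb : jacobiSym (-(c : ℤ)) b = -t := by rw [neg_eq_neg_one_mul, jacobiSym.mul_left, vᵢb, neg_one_mul]
  have vbc : jacobiSym (-(b : ℤ)) c = t := by
    rw [neg_eq_neg_one_mul, jacobiSym.mul_left, vᵢc, jacobiSym.quadratic_reciprocity_three_mod_four hb4 hc4, neg_one_mul, neg_neg]
  -- actions of `φ₁ = φ_b`
  have b_i : φ₁ D.im = (-1 : ℤ) • D.im := by rw [h₁i, vᵢb]
  have b_2 : φ₁ (D.sqrtNeg 2) = (-1 : ℤ) • D.sqrtNeg 2 := by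
    rw [h₁r 2 Nat.prime_two d2 hb2.symm, show (-((2 : ℕ) : ℤ)) = -2 by norm_num, v2b]
  have b_a : φ₁ (D.sqrtNeg a) = (-1 : ℤ) • D.sqrtNeg a := by rw [h₁r a ha da hab, vab]
  have b_c : φ₁ (D.sqrtNeg c) = (-t) • D.sqrtNeg c := by rw [h₁r c hc dc hbc.symm, vcb]
  have b_2a : φ₁ (D.sqrtNeg (2 * a)) = (-1 : ℤ) • D.sqrtNeg (2 * a) := by
    have h := TwoABC.apply_sqrtNeg_mul_smul D (hm d2) (hm da) (hm d2a) (Or.inr rfl) b_i b_2 b_a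
    rwa [show (-1 : ℤ) * -1 * -1 = -1 by ring] at h
  have b_2ac : φ₁ (D.sqrtNeg (2 * a * c)) = (-t) • D.sqrtNeg (2 * a * c) := by
    have h := TwoABC.apply_sqrtNeg_mul_smul D (hm d2a) (hm dc) (hm d2ac) (Or.inr rfl) b_i b_2a b_c
    rwa [show (-1 : ℤ) * -1 * -t = -t by ring] at h
  have h₁K' : φ₁ (D.sqrtNeg (2 * a * c * b)) = (1 : ℤ) • D.sqrtNeg (2 * a * c * b) := by
    rw [one_zsmul, show 2 * a * c * b = n by rw [hn]; ring]; exact h₁K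
  have b_b : φ₁ (D.sqrtNeg b) = t • D.sqrtNeg b := by
    have hs : (-t) = 1 ∨ (-t) = -1 := by rcases ht1 with h | h <;> rw [h] <;> norm_num
    have h := TwoABC.apply_sqrtNeg_smul_of_mul D (hm d2ac) (hm db) hn' hs b_i b_2ac h₁K'
    rwa [show (-1 : ℤ) * -t * 1 = t by ring] at h
  -- actions of `φ₂ = φ_c` on the foreign radicals
  have c_i : φ₂ D.im = (-1 : ℤ) • D.im := by rw [h₂i, vᵢc]
  have c_2 : φ₂ (D.sqrtNeg 2) = (-1 : ℤ) • D.sqrtNeg 2 := by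
    rw [h₂r 2 Nat.prime_two d2 hc2.symm, show (-((2 : ℕ) : ℤ)) = -2 by norm_num, v2c]
  have c_a : φ₂ (D.sqrtNeg a) = (-1 : ℤ) • D.sqrtNeg a := by rw [h₂r a ha da hac, vac]
  have c_b : φ₂ (D.sqrtNeg b) = t • D.sqrtNeg b := by rw [h₂r b hb db hbc, vbc]
  -- the product fixes `i, √−2, √−a, √−b, √−n`
  have ei : (φ₁ * φ₂) D.im = D.im := by
    rw [AlgEquiv.mul_apply, c_i, map_zsmul, b_i, smul_smul]; norm_num
  have e2 : (φ₁ * φ₂) (D.sqrtNeg 2) = D.sqrtNeg 2 := by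
    rw [AlgEquiv.mul_apply, c_2, map_zsmul, b_2, smul_smul]; norm_num
  have ea : (φ₁ * φ₂) (D.sqrtNeg a) = D.sqrtNeg a := by
    rw [AlgEquiv.mul_apply, c_a, map_zsmul, b_a, smul_smul]; norm_num
  have eb : (φ₁ * φ₂) (D.sqrtNeg b) = D.sqrtNeg b := by
    rw [AlgEquiv.mul_apply, c_b, map_zsmul, b_b, smul_smul, htt, one_zsmul]
  have eK : (φ₁ * φ₂) (D.sqrtNeg n) = D.sqrtNeg n := by rw [AlgEquiv.mul_apply, h₂K, h₁K]
  refine TwoRPQFive.trivialOnL_of_fix_primes_ne D hsq dvd_rfl hc dc ei eK fun p hp hpn hne => ?_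
  rcases TwoRPQFive.prime_dvd_two_rpq ha hb hc hp (by rw [← hn]; exact hpn) with rfl | rfl | rfl | rfl
  · exact e2
  · exact ea
  · exact eb
  · exact absurd rfl hne

/-! ## §3 The cell theorem -/

/-- **THE LOWER HALF OF C⁺ ON THE CELL `n = 2abc`, `a ≡ 3`, `b ≡ c ≡ 7 (mod 8)`, `(b/a) = (c/a) = −1`** (type `(3,7,7)`, `s(n) = 3`), display shape over
`D.Printed ∧ D.CMPointRingClassFrobeniusValuePrinted`: the top witness is the pair `φ_bφ_c` (§2 + `FrobeniusPairWitness.exists_pairWitness_of_clauses`),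
the proper even blocks `2a, 2b, 2c` are free, and no block `≡ 5 (mod 8)` is reached by the recursion (§1); then
`SquareSilenceStabiliser.two_dvd_scriptL_of_stabiliser_even_of_x_not_mem`.
[cite: TianYuanZhang2017, Thm. 1.1, Thm. 3.5, Lemma 3.18, §3.1, Prop. 3.2 (2), Thm. 3.6 (2), proof of Lemma 3.21] [cite: Cox2013, §5.C Cor. 5.25, §9.A] [cite: Darmon2004, Thm. 3.22] -/
theorem two_dvd_scriptL_three_seven_seven_of_valuePrinted (hGZK : rank_eq_analyticRank_of_analyticRank_le_one)
    (hsq : Squarefree n) {a b c : ℕ} (ha : a.Prime) (hb : b.Prime) (hc : c.Prime) (hn : n = 2 * a * b * c)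
    (ha8 : a % 8 = 3) (hb8 : b % 8 = 7) (hc8 : c % 8 = 7) (hba : jacobiSym (b : ℤ) a = -1) (hca : jacobiSym (c : ℤ) a = -1)
    (hra : haveI := isElliptic_congruentNumberCurve hsq.ne_zero; (congruentNumberCurve n).analyticRank = 1)
    (D : GenusPointData n) (hPr : D.Printed) (hV : D.CMPointRingClassFrobeniusValuePrinted)
    {x y : ℚ} (hxy : (congruentNumberCurve n).toAffine.Nonsingular x y)
    (hgen : haveI := isElliptic_congruentNumberCurve hsq.ne_zero;
      ∀ P, ∃ k : ℤ, IsOfFinAddOrder (P - k • (Point.some x y hxy : (congruentNumberCurve n).toAffine.Point)))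
    (hx : ¬ ∃ r : ℚ, x = r ^ 2 ∨ x = -r ^ 2 ∨ x = n * r ^ 2 ∨ x = -(n * r ^ 2))
    (hx2 : ¬ ∃ r : ℚ, x = 2 * r ^ 2 ∨ x = -(2 * r ^ 2) ∨ x = 2 * n * r ^ 2 ∨ x = -(2 * n * r ^ 2)) :
    ∀ L : ℤ, IsScriptL n L → (2 : ℤ) ∣ L := by
  have hn0 : n ≠ 0 := hsq.ne_zero
  have hnn : n ∈ n.divisors := Nat.mem_divisors_self n hn0
  have hb2 : b ≠ 2 := by omega
  have hc2 : c ≠ 2 := by omega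
  have hbc : b ≠ c := by
    rintro rfl; exact hb.one_lt.ne' (Nat.isUnit_iff.mp (hsq b ⟨2 * a, by rw [hn]; ring⟩))
  have hbc8 : (b * c) % 8 = 1 := by rw [Nat.mul_mod, hb8, hc8]
  have h6 : n % 8 = 6 := by
    rw [hn, show 2 * a * b * c = (2 * a) * (b * c) by ring, Nat.mul_mod, hbc8, Nat.mul_mod 2 a]; omega
  have d2 : 2 ∣ n := ⟨a * b * c, by rw [hn]; ring⟩
  have hn1 : 1 < n := Nat.lt_of_lt_of_le one_lt_two (Nat.le_of_dvd (Nat.pos_of_ne_zero hn0) d2)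
  have hdvdn : ∀ {d : ℕ}, d ∈ n.divisors → d ∣ 2 * a * b * c := fun hd => hn ▸ Nat.dvd_of_mem_divisors hd
  have hdvd_of_rec : ∀ {d d' : ℕ}, d' ∈ recursionIndex d → d' ∣ d := fun hd' =>
    Nat.dvd_of_mem_divisors (Finset.mem_filter.mp hd').1
  obtain ⟨hLs, -, hrec, -, h35, -, -, -, h318, -, -⟩ := hPr
  obtain ⟨z, Φ, ΓH, ΓH', σ, θ, cc, ρ₂, ρ₄, hcc, hbl⟩ := hV
  -- the top witness: the pair `φ_b φ_c`
  obtain ⟨φ₁, φ₂, ⟨h₁K, -, h₁i, h₁r⟩, ⟨h₂K, -, h₂i, h₂r⟩, hee, heH⟩ :=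
    exists_pairWitness_of_clauses D hsq hbl hnn h6 hb hc hbc (hn ▸ ⟨2 * a * c, by ring⟩) (hn ▸ ⟨2 * a * b, by ring⟩) hb2 hc2
  have heL : D.TrivialOnL n (φ₁ * φ₂) :=
    trivialOnL_pair_377 D hsq ha hb hc hn ha8 hb8 hc8 hba hca h₁K h₁i h₁r h₂K h₂i h₂r
  refine SquareSilenceStabiliser.two_dvd_scriptL_of_stabiliser_even_of_x_not_mem D hGZK hsq h6 hra hrec h35 hLs h318 z Φ ΓH ΓH' σ cc hcc
    (fun d hd => ⟨(hbl d hd).1, (hbl d hd).2.2.1⟩) (fun g _ _ _ => ?_) (fun d hd hd6 hdn => ?_)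
    (fun d hd d' hd' hd'5 => ?_) (fun d hd _ d' hd' e he he5 => ?_) hxy hgen hx hx2
  · -- the top witness kills the top character at every `g`
    exact not_sqChi_of_trivialOnL_involution D hnn hn1 ((hbl n hnn).1 (Or.inr h6)) heL hee heH g
  · -- proper even blocks `2a`, `2b`, `2c`
    rcases (divisors_two_abc_377 ha hb hc ha8 hb8 hc8 (hdvdn hd)).2 hd6 with rfl | rfl | rfl | rfl
    · exact Or.inl ⟨a, ha, rfl⟩
    · exact Or.inl ⟨b, hb, rfl⟩
    · exact Or.inl ⟨c, hc, rfl⟩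
    · exact absurd hn.symm hdn
  · -- a block `≡ 5` at level two would force `d ≡ 2 (mod 8)`, but `d ∈ R(n)` is `≡ 5, 6, 7`
    exfalso
    have h2 := mod_eight_eq_two_of_five_mem_recursionIndex ha hb hc ha8 hb8 hc8 ((hdvd_of_rec hd).trans (hn ▸ dvd_rfl)) hd' hd'5
    obtain ⟨-, h567, -, -⟩ := mem_recursionIndex_iff.mp hd
    omega
  · -- level three: the same at `d'`
    exfalso
    have h2 := mod_eight_eq_two_of_five_mem_recursionIndex ha hb hc ha8 hb8 hc8
      (((hdvd_of_rec hd').trans (hdvd_of_rec hd)).trans (hn ▸ dvd_rfl)) he he5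
    obtain ⟨-, h567, -, -⟩ := mem_recursionIndex_iff.mp hd'
    omega

/-- **THE LOWER HALF ON THE `(3,7,7)` CELL FROM THE NAMED FACTS** (`OfFacts` shape, by-name closable):
`(tyz_cmPointRingClassFrobeniusValueData ∧ thm11_parity_of_scriptL ∧ GZK)` implies — for primes `a ≡ 3`, `b ≡ c ≡ 7 (mod 8)` with `(b/a) = (c/a) = −1`,
`n = 2abc` square-free, `ord_{s=1} L(E_n, s) = 1`, and a generator `R = (x, y)` of `E_n(ℚ)` modulo torsion with `x ∉ {±1, ±2, ±n, ±2n}·ℚ^{×2}` —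
`2 ∣ L` whenever `𝓛(n)² = L²`.  (`thm11_parity_of_scriptL` is carried for uniformity with the sibling cells; this cell does not use it.)
[cite: TianYuanZhang2017, Thm. 1.1, §1, §3, Prop. 3.2 (2)] [cite: Cox2013, §5.C Cor. 5.25, §9.A] [cite: HeathBrown1994SelmerCongruentII, §1] [cite: Darmon2004, Thm. 3.22] -/
theorem two_dvd_scriptL_three_seven_seven_of_facts :
    (tyz_cmPointRingClassFrobeniusValueData ∧ thm11_parity_of_scriptL ∧ rank_eq_analyticRank_of_analyticRank_le_one) →
      ∀ n a b c : ℕ, (hsq : Squarefree n) → a.Prime → b.Prime → c.Prime → n = 2 * a * b * c → a % 8 = 3 → b % 8 = 7 → c % 8 = 7 →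
        jacobiSym (b : ℤ) a = -1 → jacobiSym (c : ℤ) a = -1 →
        (haveI := isElliptic_congruentNumberCurve hsq.ne_zero; (congruentNumberCurve n).analyticRank = 1) →
        ∀ (x y : ℚ) (hxy : (congruentNumberCurve n).toAffine.Nonsingular x y),
          (haveI := isElliptic_congruentNumberCurve hsq.ne_zero;
            ∀ P, ∃ k : ℤ, IsOfFinAddOrder (P - k • (Point.some x y hxy : (congruentNumberCurve n).toAffine.Point))) →
          (¬ ∃ r : ℚ, x = r ^ 2 ∨ x = -r ^ 2 ∨ x = n * r ^ 2 ∨ x = -(n * r ^ 2)) →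
          (¬ ∃ r : ℚ, x = 2 * r ^ 2 ∨ x = -(2 * r ^ 2) ∨ x = 2 * n * r ^ 2 ∨ x = -(2 * n * r ^ 2)) →
            ∀ L : ℤ, IsScriptL n L → (2 : ℤ) ∣ L := by
  intro h n a b c hsq ha hb hc hn ha8 hb8 hc8 hba hca hra x y hxy hgen hx hx2
  have hbc8 : (b * c) % 8 = 1 := by rw [Nat.mul_mod, hb8, hc8]
  have h6 : n % 8 = 6 := by
    rw [hn, show 2 * a * b * c = (2 * a) * (b * c) by ring, Nat.mul_mod, hbc8, Nat.mul_mod 2 a]; omega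
  obtain ⟨D, hPr, hV⟩ := h.1 n hsq (Or.inr (Or.inl h6))
  exact two_dvd_scriptL_three_seven_seven_of_valuePrinted h.2.2 hsq ha hb hc hn ha8 hb8 hc8 hba hca hra D hPr hV hxy hgen hx hx2

end Summit.BirchSwinnertonDyer.PrintCf2.ThreeSevenSeven

end
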